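import Literature.NumberTheory.EllipticCurves.Rank1Residual.Predicates
import HarnessLib

/-!
# H. Wang 2023 (Ann. Math. Québec 47), §1 hypotheses (𝔫⁺-DT) and (PO) of the multiplicity-one theorem (Thm. 9.1), SPECIALISED to the base change of an elliptic newform to a real quadratic field — the per-class predicates `DT`, `PO`, `Clean` of the D1 register

HONEST FRAMING (cell `bsd-litref`, sub-cell `bcs25`, typer seat `bsd-litref-bcs25-ty`; programme
`run/shared/lean/pub/ladder-directors/BSD-LIT2PART-PROGRAMME-v1.md` §T2): no tranche of that
programme proves BSD; the row D1 of the rank-`≤ 1` partition (Burungale–Castella–Skinner 2025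
Cor. 1.3.1, tree fact `BurungaleCastellaSkinner2025.cor131_padicValRat_bsd_rank_le_one`) stays
LITERAL under the composite reading flag
`BCS25-IMC-equiv@BSTW+Wan15-Thm3@Fuj06(unpublished)+Hid04-gap` (referee C R258 / R274). This file
holds DEFINITIONS ONLY — three decidable arithmetic predicates on a pair `(E, p)` and `Iff.rfl`-level
API — so that the register's certified witness table (`pub/bsd-ssimc/audit1/CERT-DT-WITNESS-v1.md`,
18 698 `(class, p)` instances, two engines + desk re-run, R274.1) and any future desk line about the
"CLEAN sub-population" refer to NAMED Lean predicates instead of prose. Nothing is asserted; no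
named fact is introduced; typed ≠ proved ≠ endorsed.

## What is transcribed, and why these are the right predicates

The unpublished input of BCS Cor. 1.3.1's printed proof is K. Fujiwara's freeness theorem
(arXiv:math/0602606 Thm. 12.2) entering through X. Wan, Forum Math. Sigma 3 (2015) e18, Thm. 86 (3)
→ Lemma 87 → Thm. 101 (= Thm. 3) → BCS Thm. 3.2.1 → Prop. 5.2.1 (audit of record
`pub/bsd-ssimc/audit1-DAUDIT-1-addC.md` §C.1–C.2). The ONE refereed statement of that freeness over a
totally real field is H. Wang, Ann. Math. Québec 47 (2023) 195–248 = arXiv:1909.12374, **Thm. 9.1**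
(`[corpus: paper:arxiv-1909.12374 chunk p0031:L30–31]`, verbatim): "Assume (CR⁺) and (𝔫⁺-DT) hold,
the module `S_Σ` is free over `𝕋_Σ` of rank 1", under the paper's standing hypotheses (ST), (ORD),
(PO) of §1 (`chunk p0003:L32–47`, `p0004:L30–52`):

> **Hypothesis (𝔫⁺-DT).** if `𝔩 ∥ 𝔫⁺` and `N𝔩 ≡ 1 (mod p)`, then `ρ̄_f` is ramified. (`p0004:L44–45`)
> **Hypothesis (PO).** `a_v(f)² ≢ 1 (mod p)` for all `v ∣ p` if `k = 2`. (`p0004:L49–51`)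

In the setting forced by BCS Prop. 5.2.1 (`[corpus: paper:arxiv-2405.00270 p0009:L75–p0010 L22]`):
`E/ℚ` non-CM, `p ≥ 5` good ordinary with `ρ̄_{E,p}` irreducible and (im) (⇔ surjective at `p ≥ 5`,
tree theorem `Summit.BirchSwinnertonDyer.Rank1Residual.X9.bigIm_iff_surj_of_irr`), `F` real quadratic
with `p` inert, `D_F` odd, and a prime `ℓ ∣ N` inert in `F` iff `ℓ ≡ −1 (mod p)` (else split),
`f = g_F` the base change of the newform of `E` (parallel weight `2`, level `𝔫 = N𝒪_F`, `𝔫⁻ = 1`).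
Then (audit-1 addC §C.4 (A), elementary):
* for `𝔩 ∣ ℓ` with `ℓ ∥ N`: `N𝔩 = ℓ²` if `ℓ` is inert (i.e. `ℓ ≡ −1`), `N𝔩 = ℓ` if split, so
  `N𝔩 ≡ 1 (mod p)` iff `ℓ ≡ ±1 (mod p)`; and `ρ̄_{E,p}|_{G_{F_𝔩}}` is ramified iff `ρ̄_{E,p}|_{G_{ℚ_ℓ}}`
  is (`F_𝔩/ℚ_ℓ` unramified) iff `p ∤ ord_ℓ(Δ_min)` (Tate's parametrisation at a multiplicative
  prime, Serre 1972 §1.12 — the transcription already used by the tree's `Rank1Residual.Ram`). Hence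
  **(𝔫⁺-DT) for `g_F` ⟺ `DT E p`**: no prime `ℓ ∥ N` with `p ∣ ord_ℓ(Δ_min)` and `ℓ ≡ ±1 (mod p)`.
* at the inert prime `𝔭 ∣ p`: `a_𝔭(g_F) = a_p(E)² − 2p ≡ a_p(E)² (mod p)`, so
  **(PO) for `g_F` ⟺ `PO E p`**: `a_p(E)⁴ ≢ 1 (mod p)` — identically FALSE at `p = 5` for ordinary
  `p` (`x⁴ = 1` on `𝔽₅ˣ`; `not_po_five` in the sibling `…Proofs` file), as the certified table shows (1 757/1 757 FAIL @5).
* (CR⁺), (ST), (ORD) hold automatically in that setting (addC §C.4 (A)); they are not transcribed.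
`Clean E p := DT E p ∧ PO E p` is the sub-population on which [Wang 2023, Thm. 9.1] STATES the
freeness that [Fuj06] supplies in general (referee C R274.2 prices Wang's own minimal-level input
`[Tay06]` at proof level: reading flag `Wang23-Thm9.1-minimal@Tay06-reading`; this file takes no
position on tiers). Census of record (addC §C.5): 16 245 / 18 698 D1 instances CLEAN; 5 397 / 6 602
flag-only classes CLEAN at every flagged prime; DT can fail only at `p ≤ 11` in the window.

Design notes. (1) `E` is a globally minimal `W : WeierstrassCurve ℚ` (`Δ_min`, `a_p` read off it),
`p : ℕ` any natural number (primality is the consumer's binder, as in `Rank1Residual.Ram`).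
(2) "`ℓ ∥ N`" is `W.HasMultiplicativeReductionAtPrime ℓ` and "`ρ̄_{E,p}` unramified at `ℓ`" is
`p ∣ padicValInt ℓ W.minimalDiscriminantInt`, the complement of the `Ram` witness condition
(Predicates.lean). (3) "`ℓ ≡ ±1 (mod p)`" is `(p:ℤ) ∣ ℓ − 1 ∨ (p:ℤ) ∣ ℓ + 1`. (4) Nothing here
duplicates the tree (`lean search "DT W\|PO W\|IsLevelLoweringPrime\|a_p \^ 4"`: no hits) or Mathlib.

## References
* [HWang2023AnticyclotomicHMF] H. Wang, Ann. Math. Québec 47 (2023) 195–248, doi:10.1007/s40316-022-00208-7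
  = arXiv:1909.12374: §1 Hypotheses (CR⁺) (chunk p0004:L32–40), (𝔫⁺-DT) (L44–45), (PO) (L49–51);
  §9.1, Thm. 9.1 (chunk p0031:L7–33).
* [BurungaleCastellaSkinner2025] arXiv:2405.00270v2: Hyp. 3.1.1, Thm. 3.2.1 (p. 7), Prop. 5.2.1 and
  its proof (pp. 9–10), Cor. 1.3.1 (p. 4).
* X. Wan, Forum Math. Sigma 3 (2015) e18 (`Wan2015`): Thm. 86 (3) (p. 70), Lemma 87, Thm. 101.
* `pub/bsd-ssimc/audit1-DAUDIT-1-addC.md` §C.4–C.5 (1b1a2b6717e30d36) and `audit1/CERT-DT-WITNESS-v1.md`;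
  `pub/pub-bsdpct/REFEREE.md` ROUND 274 (R274.1 desk re-run; R274.2 tier word).
-/

noncomputable section

open scoped Classical

open WeierstrassCurve Literature.NumberTheory.EllipticCurves
  Literature.NumberTheory.EllipticCurves.Rank1Residual

namespace Literature.NumberTheory.EllipticCurves.HWang2023

/-- `ℓ` is a **level-lowering prime** of `(E, p)`: a prime of multiplicative reduction (`ℓ ∥ N`) at
which `ρ̄_{E,p}` is UNRAMIFIED, i.e. `p ∣ ord_ℓ(Δ_min)` (Tate curve; the negation of the witness
condition of `Rank1Residual.Ram`). These are the primes `v ∣ ℓ` of `F` at which the Artin conductor of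
`ρ̄_{E,p}|_{G_F}` drops below the level `N𝒪_F` (Wang's `𝔫/𝔫_{ρ̄}`; BCS/Wan's non-minimal primes).
[cite: HWang2023AnticyclotomicHMF, §9.1 (chunk p0031:L7–9, `𝔫₀ = 𝔫_{ρ̄_f}`, `𝔫/𝔫_∅`)] -/
def IsLevelLoweringPrime (W : WeierstrassCurve ℚ) [W.IsGloballyMinimal] (p ℓ : ℕ) [Fact ℓ.Prime] :
    Prop :=
  W.HasMultiplicativeReductionAtPrime ℓ ∧ p ∣ padicValInt ℓ W.minimalDiscriminantInt

/-- **`DT E p`** — Wang's Hypothesis (𝔫⁺-DT) ("if `𝔩 ∥ 𝔫⁺` and `N𝔩 ≡ 1 (mod p)`, then `ρ̄_f` is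
ramified") SPECIALISED to `f = g_F`, the base change of the newform of `E` to a real quadratic `F`
in which a prime `ℓ ∣ N` is inert iff `ℓ ≡ −1 (mod p)` (the setting of BCS Prop. 5.2.1): there is NO
level-lowering prime `ℓ` of `(E, p)` with `ℓ ≡ ±1 (mod p)` (module docstring for the two-line
equivalence: `N𝔩 ∈ {ℓ, ℓ²}`, and ramification at `𝔩` = ramification at `ℓ`). Decidable on the class
data; certified per `(class, p)` in `CERT-DT-WITNESS-v1`.
[cite: HWang2023AnticyclotomicHMF, §1 Hypothesis (𝔫⁺-DT) (chunk p0004:L44–45)]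
[cite: BurungaleCastellaSkinner2025, Prop. 5.2.1 (iii) (p. 9 of arXiv:2405.00270v2)] -/
def DT (W : WeierstrassCurve ℚ) [W.IsGloballyMinimal] (p : ℕ) : Prop :=
  ∀ ℓ : ℕ, (hℓ : ℓ.Prime) → (haveI : Fact ℓ.Prime := ⟨hℓ⟩; IsLevelLoweringPrime W p ℓ) →
    ¬ ((p : ℤ) ∣ (ℓ : ℤ) - 1 ∨ (p : ℤ) ∣ (ℓ : ℤ) + 1)

/-- **`PO E p`** — Wang's Hypothesis (PO) ("`a_v(f)² ≢ 1 (mod p)` for all `v ∣ p` if `k = 2`")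
SPECIALISED to `f = g_F` with `p` INERT in the real quadratic `F`: `a_𝔭(g_F) = a_p(E)² − 2p ≡ a_p(E)²`,
so (PO) reads `a_p(E)⁴ ≢ 1 (mod p)`, i.e. `p ∤ a_p⁴ − 1` (`a_p = W.frobeniusTrace p` on the globally
minimal model). Identically false at an ordinary `p = 5` (`HWang2023.not_po_five`, sibling `…Proofs` file).
[cite: HWang2023AnticyclotomicHMF, §1 Hypothesis (PO) (chunk p0004:L49–51)]
[cite: BurungaleCastellaSkinner2025, Prop. 5.2.1 (i) (p inert in F) (p. 9 of arXiv:2405.00270v2)] -/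
def PO (W : WeierstrassCurve ℚ) [W.IsGloballyMinimal] (p : ℕ) : Prop :=
  ¬ (p : ℤ) ∣ W.frobeniusTrace p ^ 4 - 1

/-- **`Clean E p := DT E p ∧ PO E p`** — the sub-population of the D1 register on which Wang 2023
Thm. 9.1 states "`S_Σ` is free over `𝕋_Σ` of rank 1" for the base-changed form (its remaining
hypotheses (CR⁺), (ST), (ORD) being automatic there); 16 245 / 18 698 D1 instances and 5 397 / 6 602
flag-only classes (addC §C.5). A NAME for a register sub-population; nothing asserted.
[cite: HWang2023AnticyclotomicHMF, Thm. 9.1 (chunk p0031:L30–31)] -/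
def Clean (W : WeierstrassCurve ℚ) [W.IsGloballyMinimal] (p : ℕ) : Prop :=
  DT W p ∧ PO W p

variable (W : WeierstrassCurve ℚ) [W.IsGloballyMinimal] (p : ℕ)

/-- Unfolding `IsLevelLoweringPrime` (bookkeeping; nothing asserted). [cite: HWang2023AnticyclotomicHMF, §9.1 (chunk p0031:L7–9), unfolding only] -/
theorem isLevelLoweringPrime_iff (ℓ : ℕ) [Fact ℓ.Prime] :
    IsLevelLoweringPrime W p ℓ ↔
      W.HasMultiplicativeReductionAtPrime ℓ ∧ p ∣ padicValInt ℓ W.minimalDiscriminantInt :=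
  Iff.rfl

/-- Unfolding `DT` (bookkeeping; nothing asserted). [cite: HWang2023AnticyclotomicHMF, §1 Hypothesis (𝔫⁺-DT) (chunk p0004:L44–45), unfolding only] -/
theorem dt_iff : DT W p ↔
    ∀ ℓ : ℕ, (hℓ : ℓ.Prime) → (haveI : Fact ℓ.Prime := ⟨hℓ⟩; IsLevelLoweringPrime W p ℓ) →
      ¬ ((p : ℤ) ∣ (ℓ : ℤ) - 1 ∨ (p : ℤ) ∣ (ℓ : ℤ) + 1) :=
  Iff.rfl

/-- Unfolding `PO` (bookkeeping; nothing asserted). [cite: HWang2023AnticyclotomicHMF, §1 Hypothesis (PO) (chunk p0004:L49–51), unfolding only] -/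
theorem po_iff : PO W p ↔ ¬ (p : ℤ) ∣ W.frobeniusTrace p ^ 4 - 1 := Iff.rfl

/-- Unfolding `Clean` (bookkeeping; nothing asserted). [cite: HWang2023AnticyclotomicHMF, Thm. 9.1 hypotheses (chunk p0031:L30–31), unfolding only] -/
theorem clean_iff : Clean W p ↔ DT W p ∧ PO W p := Iff.rfl

end Literature.NumberTheory.EllipticCurves.HWang2023

end
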